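import Summits.BirchSwinnertonDyer.BirchSwinnertonDyer.Theorems.RefFifteenHalvedTameMeasure
import Summits.BirchSwinnertonDyer.BirchSwinnertonDyer.Theorems.HalvedTameRiemannSumsAtTwo
import Summits.BirchSwinnertonDyer.BirchSwinnertonDyer.Theorems.TwoAdicConverseKidaAnalyticOfCongruence
import Summits.BirchSwinnertonDyer.BirchSwinnertonDyer.Theorems.LambdaTransportDoorAtTwoMatsunoClass
import Summits.BirchSwinnertonDyer.Rank2.RefFifteenLocalTerms
import HarnessLib

/-!
# The halved twist congruence at `2` for `15A8` and the ANALYTIC Kida formula on its twist class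

Cell `bsd-rank2`, seat p2, GEN 64 (helper toward `EisensteinDepletionAtTwo.DepletedLambdaLawAtTwoModNSF`,
stmt-BirchSwinnertonDyer-27021).  `E₀ = 15A8 = [1,1,1,0,0]`, `f₀` its newform, `α₀` the unit root of `X² + X + 2`.

THE OBSTRUCTION REMOVED.  `L₂(f₀, α₀) = 2·ι(u)` with `u ∈ Λˣ` (`refFifteen_exists_isUnit_iwasawa`): `μ^{an}(E₀) = 1`,
so Matsuno's mod-`2` twist congruence `exists_iwasawa_twist_congr_two` (`c·L₂(A) ≡ v·L₂(E₀)·∏𝒫_ℓ`) reads `0 ≡ 0`.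
Here the congruence is proved for the HALVED functions: by part 1 (`RefFifteenHalvedTameMeasure`: the tame measure
of `15A8` is `ℤ₂`-valued on the unit classes) and the unit-class Riemann-sum bounds
(`HalvedTameRiemannSumsAtTwo`), `½·L₂(f₀,m,α₀,χ)` and `½·L₂(f₀,m,α₀,𝟙)` are integral and congruent mod `2Λ` for
every `m` prime to `30` and every even quadratic `χ mod m` (§1); the scaled depletion lift and Birch's lemma give
(§2), for EVERY globally minimal model `A` of `E₀^{(d)}`, `d > 0` squarefree, `d ≡ 1 (mod 4)`, `(d, 30) = 1`:
  `∃ c_A ∈ ℚˣ, L_A' ∈ Λ:  ι L_A' = C(c_A)·L₂(f_A, α_A)`,  `L_A' ≡ v·u·∏_{ℓ∣d}𝒫_ℓ (mod 2Λ)`,  hence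
  **`μ(L_A') = 0` and `λ(L_A') = kidaShiftAtTwo E₀ d`** — the ANALYTIC Kida formula at `2` on the whole admissible
  twist class of `15A8`, unconditional modulo modularity (`hmod`, the only displayed input); **`= 2`** for `d = ℓ`
  prime, `ℓ ≡ 5 (mod 8)` (`#Ẽ₀(𝔽_ℓ)` is even: rational `2`-torsion).
This is the analytic half of Matsuno 2008 Example 1 (`λ = 2` on `{15A8^{(ℓ)} : ℓ ≡ 5 (8)}`) with NO main-conjecture,
rank or `L`-value input; the companion door file turns it into `char X₂(A/ℚ_∞) = (T²)` and `corank = ord_T L₂`.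

B1 honesty: nothing here bears on `ord_{s=1} L(A,s)`; these are statements about `2`-adic `L`-functions.
-/

noncomputable section

open scoped Classical MatrixGroups ModularForm NumberTheorySymbols

open CongruenceSubgroup Filter Topology NumberField IsDedekindDomain WeierstrassCurve PowerSeries
  Literature.NumberTheory.EllipticCurves Literature.NumberTheory.EllipticCurves.ModularForms
  Literature.NumberTheory.EllipticCurves.GreenbergVatsal2000
  Summit.BirchSwinnertonDyer.Rank1Residual.X1.MuLambda
  Summit.BirchSwinnertonDyer.Rank2 Summit.BirchSwinnertonDyer.Rank2.SymbolParityAtTwo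
  Summit.BirchSwinnertonDyer.Rank2.LevelFifteen
  Summit.BirchSwinnertonDyer.BirchSwinnertonDyer.Theorems.TwoAdicTwistConverse
  Summit.BirchSwinnertonDyer.BirchSwinnertonDyer.Theorems.RefFifteenHalvedTameMeasure
  Summit.BirchSwinnertonDyer.BirchSwinnertonDyer.Theorems.HalvedTameRiemannSumsAtTwo

namespace Summit.BirchSwinnertonDyer.BirchSwinnertonDyer.Theorems.RefFifteenHalvedTameCongruence

/-! ## §0. Helpers -/

section Helpers

/-- `‖2‖₂ = 1/2`. [folklore] -/
private theorem norm_two_two : ‖(2 : ℚ_[2])‖ = (2 : ℝ)⁻¹ := by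
  have h := Padic.norm_p (p := 2)
  simpa using h


/-- Distinct finite places of `ℚ` lie over distinct primes. [folklore] -/
private theorem natGenerator_injective_rat :
    Function.Injective (Rat.HeightOneSpectrum.natGenerator (R := 𝓞 ℚ)) := fun _ _ h ↦
  (Rat.HeightOneSpectrum.primesEquiv (R := 𝓞 ℚ)).injective (Subtype.ext h)


end Helpers

/-! ## §1. The halved pair and the halved depletion congruence for `15A8` -/

section Halved

variable {N : ℕ} [NeZero N] {m : ℕ} [NeZero m]

omit [NeZero m] in
/-- The trivial character mod `m` is even. [folklore] -/
private theorem even_one : (1 : DirichletCharacter ℚ_[2] m).Even := by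
  show (1 : DirichletCharacter ℚ_[2] m) (-1) = 1
  rw [MulChar.one_apply (isUnit_one.neg)]

/-- **THE HALVED PAIR for `15A8`.** For `f` a newform of `E₀ = [1,1,1,0,0]`, `α = α₂(E₀)`, `m` prime to `30` and
`χ` an EVEN QUADRATIC `ℚ₂`-valued character mod `m`: there are `G, G₁ ∈ Λ` with `ι G = ½·L₂(f,m,α,χ)`,
`ι G₁ = ½·L₂(f,m,α,𝟙_m)` and `G ≡ G₁ (mod 2Λ)` — the unit-class measure bound `1` (§2) gives Riemann sums of
norm `≤ ½` and differences of norm `≤ ¼`, which survive the limit (`tendsto_padicLRiemannSumTame_unitRoot_two`).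
[cite: Matsuno2000, Lemma 3.2 (p. 87)] [cite: MazurTateTeitelbaum1986Invent, §I.12–§I.13] -/
theorem refFifteen_exists_halved_pair (hmin : (⟨1, 1, 1, 0, 0⟩ : WeierstrassCurve ℚ).IsGloballyMinimal)
    {f : CuspForm (Gamma0 N) 2} (hW : IsNewformOf (⟨1, 1, 1, 0, 0⟩ : WeierstrassCurve ℚ) f) (hm30 : m.Coprime 30)
    (χ : DirichletCharacter ℚ_[2] m) (hχ : χ.Even) (hsq : χ ^ 2 = 1) :
    ∃ G G₁ : IwasawaAlgebra 2,
      iwasawaToPowerSeries 2 G = PowerSeries.C ((2 : ℚ_[2])⁻¹) *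
        padicLFunctionTame f m (@unitRoot (⟨1, 1, 1, 0, 0⟩ : WeierstrassCurve ℚ) hmin 2 _ : ℚ_[2]) χ ∧
      iwasawaToPowerSeries 2 G₁ = PowerSeries.C ((2 : ℚ_[2])⁻¹) *
        padicLFunctionTame f m (@unitRoot (⟨1, 1, 1, 0, 0⟩ : WeierstrassCurve ℚ) hmin 2 _ : ℚ_[2]) 1 ∧
      PowerSeries.map (PadicInt.toZMod (p := 2)) G = PowerSeries.map (PadicInt.toZMod (p := 2)) G₁ := by
  haveI : (⟨1, 1, 1, 0, 0⟩ : WeierstrassCurve ℚ).IsElliptic := refFifteen_isElliptic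
  have hord := refFifteen_isOrdinaryAt_two hmin
  obtain ⟨hαeq, hαu, -⟩ := unitRoot_coe_spec (W := (⟨1, 1, 1, 0, 0⟩ : WeierstrassCurve ℚ)) hord
  rw [refFifteen_frobeniusTrace_two hmin] at hαeq
  set α : ℚ_[2] := (@unitRoot (⟨1, 1, 1, 0, 0⟩ : WeierstrassCurve ℚ) hmin 2 _ : ℚ_[2]) with hα
  have hroot : α ^ 2 + α + 2 = 0 := by
    have h := hαeq
    push_cast at h
    linear_combination h
  have hm2 : m.Coprime 2 := Nat.Coprime.coprime_dvd_right (by norm_num : 2 ∣ 30) hm30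
  have hμ : ∀ (n : ℕ) (a : ZMod (2 ^ (n + 2))) (b : ZMod m), Odd a.val → IsUnit b →
      ‖msdMeasureTame f m α (n + 2) a b‖ ≤ 1 := fun n a b ha hb ↦
    refFifteen_norm_msdMeasureTame_le_one hW hαu hroot hm30 (n + 1) a ha b hb
  -- Riemann sums: `‖RS(χ)‖ ≤ ½`, `‖RS(χ) − RS(𝟙)‖ ≤ ¼`
  have hRS : ∀ (ψ : DirichletCharacter ℚ_[2] m), ψ.Even → ∀ k n, ‖padicLRiemannSumTame f m α ψ k n‖ ≤ 2⁻¹ := by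
    intro ψ hψ k n
    have h := norm_padicLRiemannSumTame_two_le_of_units f hm2 α ψ hψ zero_le_one hμ k n
    rwa [norm_two_two, mul_one] at h
  have hRSsub : ∀ k n, ‖padicLRiemannSumTame f m α χ k n - padicLRiemannSumTame f m α 1 k n‖ ≤ 2⁻¹ * 2⁻¹ := by
    intro k n
    have h := norm_padicLRiemannSumTame_sub_two_le_of_units f hm2 α χ 1 hχ even_one (norm_nonneg _)
      (norm_sub_one_apply_le_of_sq_eq_one χ hsq) zero_le_one hμ k n
    rwa [norm_two_two, mul_one] at h
  -- coefficients in the limit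
  have hco : ∀ (ψ : DirichletCharacter ℚ_[2] m), ψ.Even → ∀ k, ‖padicLCoeffTame f m α ψ k‖ ≤ 2⁻¹ :=
    fun ψ hψ k ↦ le_of_tendsto (tendsto_padicLRiemannSumTame_unitRoot_two hord hW hm2 ψ k).norm
      (Eventually.of_forall (hRS ψ hψ k))
  have hcosub : ∀ k, ‖padicLCoeffTame f m α χ k - padicLCoeffTame f m α 1 k‖ ≤ 2⁻¹ * 2⁻¹ := fun k ↦
    le_of_tendsto ((tendsto_padicLRiemannSumTame_unitRoot_two hord hW hm2 χ k).sub
      (tendsto_padicLRiemannSumTame_unitRoot_two hord hW hm2 1 k)).norm (Eventually.of_forall (hRSsub k))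
  have h2inv : ‖(2 : ℚ_[2])⁻¹‖ = 2 := by rw [norm_inv, norm_two_two, inv_inv]
  refine exists_iwasawa_pair_map_toZMod_eq _ _ (fun k ↦ ?_) (fun k ↦ ?_) (fun k ↦ ?_)
  · rw [PowerSeries.coeff_C_mul, coeff_padicLFunctionTame, norm_mul, h2inv]
    calc (2 : ℝ) * _ ≤ 2 * 2⁻¹ := by gcongr; exact hco χ hχ k
      _ = 1 := by norm_num
  · rw [PowerSeries.coeff_C_mul, coeff_padicLFunctionTame, norm_mul, h2inv]
    calc (2 : ℝ) * _ ≤ 2 * 2⁻¹ := by gcongr; exact hco 1 even_one k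
      _ = 1 := by norm_num
  · rw [PowerSeries.coeff_C_mul, PowerSeries.coeff_C_mul, coeff_padicLFunctionTame, coeff_padicLFunctionTame,
      ← mul_sub, norm_mul, h2inv]
    calc (2 : ℝ) * _ ≤ 2 * (2⁻¹ * 2⁻¹) := by gcongr; exact hcosub k
      _ < 1 := by norm_num

/-- **THE HALVED DEPLETION CONGRUENCE for `15A8`**: for `f` a newform of `E₀ = [1,1,1,0,0]`, `S₀` a finite set of
places over odd primes of good reduction with `m = ∏ ℓ_v` prime to `30`, and `χ` an even quadratic character mod
`m`: `∃ u, G ∈ Λ`, `v ∈ Λˣ` with `u` a UNIT, `ι u = ½·L₂(f,α)`, `ι G = ½·L₂(f,m,α,χ)` and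
**`G ≡ v·u·∏_{v∈S₀}𝒫_v (mod 2Λ)`** (§3 + the scaled depletion lift, glued by `iwasawaToPowerSeries_injective`).
[cite: Matsuno2000, Lemmas 3.2–3.3 and proof of Theorem 3.1 (pp. 87–88)] -/
theorem refFifteen_exists_halved_congr (hmin : (⟨1, 1, 1, 0, 0⟩ : WeierstrassCurve ℚ).IsGloballyMinimal)
    {f : CuspForm (Gamma0 N) 2} (hW : IsNewformOf (⟨1, 1, 1, 0, 0⟩ : WeierstrassCurve ℚ) f)
    (S₀ : Finset (HeightOneSpectrum (𝓞 ℚ)))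
    (hS2 : ∀ v ∈ S₀, Rat.HeightOneSpectrum.natGenerator v ≠ 2)
    (hgood : ∀ v ∈ S₀, (⟨1, 1, 1, 0, 0⟩ : WeierstrassCurve ℚ).HasGoodReductionAt v)
    {m : ℕ} [NeZero m] (hm : m = ∏ v ∈ S₀, Rat.HeightOneSpectrum.natGenerator v) (hm30 : m.Coprime 30)
    (χ : DirichletCharacter ℚ_[2] m) (hχ : χ.Even) (hsq : χ ^ 2 = 1) :
    ∃ (u G : IwasawaAlgebra 2) (v : (IwasawaAlgebra 2)ˣ), IsUnit u ∧
      iwasawaToPowerSeries 2 u = PowerSeries.C ((2 : ℚ_[2])⁻¹) *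
        padicLFunction f (@unitRoot (⟨1, 1, 1, 0, 0⟩ : WeierstrassCurve ℚ) hmin 2 _ : ℚ_[2]) ∧
      iwasawaToPowerSeries 2 G = PowerSeries.C ((2 : ℚ_[2])⁻¹) *
        padicLFunctionTame f m (@unitRoot (⟨1, 1, 1, 0, 0⟩ : WeierstrassCurve ℚ) hmin 2 _ : ℚ_[2]) χ ∧
      PowerSeries.map (PadicInt.toZMod (p := 2)) G =
        PowerSeries.map (PadicInt.toZMod (p := 2))
          ((v : IwasawaAlgebra 2) * u * eulerFactorProduct (⟨1, 1, 1, 0, 0⟩ : WeierstrassCurve ℚ) 2 S₀) := by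
  haveI : (⟨1, 1, 1, 0, 0⟩ : WeierstrassCurve ℚ).IsElliptic := refFifteen_isElliptic
  haveI : (⟨1, 1, 1, 0, 0⟩ : WeierstrassCurve ℚ).IsGloballyMinimal := hmin
  have hord := refFifteen_isOrdinaryAt_two hmin
  obtain ⟨u, hunit, hu⟩ := refFifteen_exists_isUnit_iwasawa hmin hW
  obtain ⟨G, G₁, hG, hG₁, hGG₁⟩ := refFifteen_exists_halved_pair (m := m) hmin hW hm30 χ hχ hsq
  obtain ⟨G₁', v, hG₁', hcongr⟩ := exists_scaled_depletion_lift_two (W := (⟨1, 1, 1, 0, 0⟩ : WeierstrassCurve ℚ))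
    hord hW S₀ hS2 hgood hm hu
  have hEq : G₁ = G₁' := iwasawaToPowerSeries_injective 2 (hG₁.trans hG₁'.symm)
  exact ⟨u, G, v, hunit, hu, hG, by rw [hGG₁, hEq, hcongr]⟩


end Halved

/-! ## §2. Birch's lemma and the analytic Kida formula on the twist class of `15A8` -/

section Twist

variable {W₀ : WeierstrassCurve ℚ} [W₀.IsElliptic] [W₀.IsGloballyMinimal] [NeZero (W₀.conductorNorm ℤ)]
  {A : WeierstrassCurve ℚ} [A.IsElliptic] [A.IsGloballyMinimal] [NeZero (A.conductorNorm ℤ)]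

/-- **THE HALVED TWIST CONGRUENCE for `15A8`** (Matsuno 2000 Thm. 3.1 read at `p = 2` for the HALVED
`2`-adic `L`-function of `E₀ = [1,1,1,0,0]`): for `d > 0` squarefree, `d ≡ 1 (mod 4)`, `(d, 30) = 1`, `A` a
globally minimal model of `E₀^{(d)}` with newform `f_A`, `f₀` the newform of `E₀`, and `S₀` the places over the
primes of `d`: there are a UNIT `u ∈ Λ` (`ι u = ½ L₂(f₀, α₀)`), `L_A' ∈ Λ`, `c_A ∈ ℚˣ`, `v ∈ Λˣ` with
`ι L_A' = C(c_A)·L₂(f_A, α_A)` and **`L_A' ≡ v·u·∏_{ℓ∣d}𝒫_ℓ (mod 2Λ)`** (Birch's lemma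
`exists_padicLFunction_twist_eq_C_mul_padicLFunctionTame` × §4). [cite: Matsuno2000, Thm. 3.1 (p. 86)]
[cite: MazurTateTeitelbaum1986Invent, §I.8] -/
theorem refFifteen_exists_twist_halved_congr (hW₀ : W₀ = ⟨1, 1, 1, 0, 0⟩) (hmod : exists_isNewformOf)
    {d : ℤ} (hd : 0 < d) (hd4 : d % 4 = 1) (hsq : Squarefree d) (h30 : IsCoprime d 30)
    {C : VariableChange ℚ} (hA : C • W₀.quadraticTwist (d : ℚ) = A)
    {f₀ : CuspForm (Gamma0 (W₀.conductorNorm ℤ)) 2} (hf₀ : IsNewformOf W₀ f₀)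
    {fA : CuspForm (Gamma0 (A.conductorNorm ℤ)) 2} (hfA : IsNewformOf A fA)
    (S₀ : Finset (HeightOneSpectrum (𝓞 ℚ)))
    (hS₀ : S₀.image Rat.HeightOneSpectrum.natGenerator = d.natAbs.primeFactors) :
    ∃ (u LA' : IwasawaAlgebra 2) (cA : ℚ) (v : (IwasawaAlgebra 2)ˣ), IsUnit u ∧
      iwasawaToPowerSeries 2 u = PowerSeries.C ((2 : ℚ_[2])⁻¹) * padicLFunction f₀ (unitRoot W₀ 2 : ℚ_[2]) ∧
      cA ≠ 0 ∧
      iwasawaToPowerSeries 2 LA' = PowerSeries.C (cA : ℚ_[2]) * padicLFunction fA (unitRoot A 2 : ℚ_[2]) ∧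
      PowerSeries.map (PadicInt.toZMod (p := 2)) LA' =
        PowerSeries.map (PadicInt.toZMod (p := 2)) ((v : IwasawaAlgebra 2) * u * eulerFactorProduct W₀ 2 S₀) := by
  subst hW₀
  have hmin : (⟨1, 1, 1, 0, 0⟩ : WeierstrassCurve ℚ).IsGloballyMinimal := inferInstance
  have hord := refFifteen_isOrdinaryAt_two hmin
  have hN : (⟨1, 1, 1, 0, 0⟩ : WeierstrassCurve ℚ).conductorNorm ℤ = 15 := refFifteen_conductorNorm
  have hcop : IsCoprime d ((⟨1, 1, 1, 0, 0⟩ : WeierstrassCurve ℚ).conductorNorm ℤ : ℤ) := by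
    have h' : IsCoprime d ((15 : ℤ) * 2) := by norm_num; exact h30
    rw [hN]; exact h'.of_mul_right_left
  have hd0 : d ≠ 0 := hd.ne'
  haveI : NeZero d.natAbs := ⟨Int.natAbs_ne_zero.mpr hd0⟩
  have hsq' : Squarefree d.natAbs := Int.squarefree_natAbs.mpr hsq
  have hm4 : d.natAbs % 4 = 1 := by omega
  have hd2 : ¬ (2 : ℤ) ∣ d := by omega
  have hm30 : d.natAbs.Coprime 30 := by
    have h := Int.isCoprime_iff_gcd_eq_one.mp h30
    rw [Int.gcd_eq_natAbs] at h
    exact h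
  obtain ⟨χ, hχ⟩ := exists_mulChar_int_eq_jacobiSym d.natAbs
  obtain ⟨c, hc0, hL⟩ :=
    exists_padicLFunction_twist_eq_C_mul_padicLFunctionTame (⟨1, 1, 1, 0, 0⟩ : WeierstrassCurve ℚ) hmod hd hd4 hsq
      hcop hA hf₀ hfA hord hd2 hχ
  set χ₂ : DirichletCharacter ℚ_[2] d.natAbs :=
    (χ.ringHomComp (Int.castRingHom ℚ)).ringHomComp (Rat.castHom ℚ_[2]) with hχ₂_def
  have hχ₂even : χ₂.Even := by
    show χ₂ (-1) = 1
    rw [hχ₂_def, MulChar.ringHomComp_apply, MulChar.ringHomComp_apply, mulChar_jacobi_apply_neg_one hχ hm4, map_one,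
      map_one]
  have hχ₂sq : χ₂ ^ 2 = 1 := by
    have : χ₂ = χ.ringHomComp ((Rat.castHom ℚ_[2]).comp (Int.castRingHom ℚ)) := MulChar.ext' fun a ↦ rfl
    rw [this]
    exact mulChar_jacobi_ringHomComp_sq hχ _
  -- the places over the primes of `d`
  have hS2 : ∀ v ∈ S₀, Rat.HeightOneSpectrum.natGenerator v ≠ 2 := by
    intro v hv h
    have hmem : Rat.HeightOneSpectrum.natGenerator v ∈ d.natAbs.primeFactors := hS₀ ▸ Finset.mem_image_of_mem _ hv
    rw [h] at hmem
    exact hd2 (Int.natCast_dvd.mpr (Nat.dvd_of_mem_primeFactors hmem))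
  have hgood : ∀ v ∈ S₀, (⟨1, 1, 1, 0, 0⟩ : WeierstrassCurve ℚ).HasGoodReductionAt v := by
    intro v hv
    refine hasGoodReductionAt_of_not_dvd_conductorNorm _ v fun hvN ↦ ?_
    have hmem : Rat.HeightOneSpectrum.natGenerator v ∈ d.natAbs.primeFactors := hS₀ ▸ Finset.mem_image_of_mem _ hv
    have hℓ : (Rat.HeightOneSpectrum.natGenerator v).Prime := Nat.prime_of_mem_primeFactors hmem
    have hℓd : (Rat.HeightOneSpectrum.natGenerator v : ℤ) ∣ d := Int.natCast_dvd.mpr (Nat.dvd_of_mem_primeFactors hmem)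
    have hu := Int.isUnit_iff_natAbs_eq.mp
      (hcop.isUnit_of_dvd' hℓd (Int.natCast_dvd_natCast.mpr hvN))
    rw [Int.natAbs_natCast] at hu
    exact hℓ.one_lt.ne' hu
  have hm : d.natAbs = ∏ v ∈ S₀, Rat.HeightOneSpectrum.natGenerator v := by
    have h := Nat.prod_primeFactors_of_squarefree hsq'
    rw [← hS₀, Finset.prod_image fun v _ w _ h ↦ natGenerator_injective_rat h] at h
    exact h.symm
  obtain ⟨u, G, v, hunit, hu, hG, hGc⟩ :=
    refFifteen_exists_halved_congr hmin hf₀ S₀ hS2 hgood hm hm30 χ₂ hχ₂even hχ₂sq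
  -- the unit `(1+T)^{−f_m}` of `Λ` and the constant `2c`
  set B : IwasawaAlgebra 2 := PowerSeries.binomialSeries ℤ_[2] (-frobeniusExponent 2 (d.natAbs : ℤ_[2])) with hB
  have hBu : IsUnit B :=
    isUnit_iff_exists_inv.mpr ⟨PowerSeries.binomialSeries ℤ_[2] (frobeniusExponent 2 (d.natAbs : ℤ_[2])), by
      rw [hB, ← PowerSeries.binomialSeries_add, neg_add_cancel, PowerSeries.binomialSeries_zero]⟩
  have hcQ : (c : ℚ_[2]) ≠ 0 := by exact_mod_cast hc0
  refine ⟨u, B * G, (2 * c)⁻¹, hBu.unit * v, hunit, hu, inv_ne_zero (mul_ne_zero two_ne_zero hc0), ?_, ?_⟩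
  · rw [map_mul, hG, hB, BurungaleSkinner2023.iwasawaToPowerSeries_binomialSeries, hL]
    have h2c : (((2 * c)⁻¹ : ℚ) : ℚ_[2]) = ((2 : ℚ_[2]) * c)⁻¹ := by push_cast; ring
    have key : PowerSeries.C (((2 : ℚ_[2]) * c)⁻¹) * PowerSeries.C (c : ℚ_[2]) = PowerSeries.C (2 : ℚ_[2])⁻¹ := by
      rw [← map_mul, mul_inv, mul_assoc, inv_mul_cancel₀ hcQ, mul_one]
    rw [h2c]
    linear_combination (-(PowerSeries.binomialSeries ℚ_[2] (-frobeniusExponent 2 (d.natAbs : ℤ_[2])) *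
      padicLFunctionTame f₀ d.natAbs (unitRoot (⟨1, 1, 1, 0, 0⟩ : WeierstrassCurve ℚ) 2 : ℚ_[2]) χ₂)) * key
  · rw [map_mul, hGc, ← map_mul, Units.val_mul, IsUnit.unit_spec]
    congr 1
    ring

/-- **THE ANALYTIC KIDA FORMULA AT `2` ON THE TWIST CLASS OF `15A8`, unconditional modulo modularity.**  For
`E₀ = [1,1,1,0,0]`, `d > 0` squarefree, `d ≡ 1 (mod 4)`, `(d, 30) = 1`, and EVERY globally minimal model `A` of
`E₀^{(d)}` with newform `f_A`: there are `c_A ∈ ℚˣ` and `L_A' ∈ Λ`, `L_A' ≠ 0`, with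
`ι L_A' = C(c_A)·L₂(f_A, α_A)`, **`μ(L_A') = 0` and `λ(L_A') = kidaShiftAtTwo E₀ d`** (`λ^{an}(E₀) = 0` for the
halved unit `u`; transport `mu_eq_zero_and_lam_eq_add_kidaShift_of_congruence`).  The only displayed input is
`hmod : exists_isNewformOf` (modularity, used for the newform of `E₀` and Birch's lemma).
[cite: Matsuno2000, Thm. 3.1 (p. 86)] [cite: GreenbergVatsal2000, §1 p. 9 (display (9))]
[cite: MazurTateTeitelbaum1986Invent, §I.8, §I.10–§I.13] -/
theorem refFifteen_twist_mu_eq_zero_and_lam_eq_kidaShift (hW₀ : W₀ = ⟨1, 1, 1, 0, 0⟩) (hmod : exists_isNewformOf)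
    {d : ℤ} (hd : 0 < d) (hd4 : d % 4 = 1) (hsq : Squarefree d) (h30 : IsCoprime d 30)
    (hA : ∃ C : VariableChange ℚ, C • W₀.quadraticTwist (d : ℚ) = A)
    {fA : CuspForm (Gamma0 (A.conductorNorm ℤ)) 2} (hfA : IsNewformOf A fA) :
    ∃ (cA : ℚ) (LA' : IwasawaAlgebra 2), cA ≠ 0 ∧ LA' ≠ 0 ∧
      iwasawaToPowerSeries 2 LA' = PowerSeries.C (cA : ℚ_[2]) * padicLFunction fA (unitRoot A 2 : ℚ_[2]) ∧
      mu LA' = 0 ∧ lam LA' = kidaShiftAtTwo W₀ d := by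
  obtain ⟨C, hC⟩ := hA
  obtain ⟨f₀, hf₀⟩ := hmod W₀
  obtain ⟨S₀, hS₀⟩ := DepletionAtTwo.exists_image_natGenerator_eq d.natAbs.primeFactors
    (fun ℓ hℓ ↦ Nat.prime_of_mem_primeFactors hℓ)
  obtain ⟨u, LA', cA, v, hunit, -, hcA, hLA', hcong⟩ :=
    refFifteen_exists_twist_halved_congr hW₀ hmod hd hd4 hsq h30 hC hf₀ hfA S₀ hS₀
  obtain ⟨hu0, hμu, hlamu⟩ := (isUnit_iff_mu_eq_zero_and_lam_eq_zero u).mp hunit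
  have hN : W₀.conductorNorm ℤ = 15 := by subst hW₀; exact refFifteen_conductorNorm
  have hcop : IsCoprime d (W₀.conductorNorm ℤ : ℤ) := by
    have h' : IsCoprime d ((15 : ℤ) * 2) := by norm_num; exact h30
    rw [hN]; exact h'.of_mul_right_left
  have hd2 : ¬ (2 : ℤ) ∣ d := by omega
  obtain ⟨hLA'0, hμA, hlamA⟩ :=
    mu_eq_zero_and_lam_eq_add_kidaShift_of_congruence W₀ hcop hd2 hS₀ v hu0 hμu hcong
  exact ⟨cA, LA', hcA, hLA'0, hLA', hμA, by rw [hlamA, hlamu, zero_add]⟩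

/-- **`λ^{an} = 2` on the Matsuno class `{15A8^{(ℓ)} : ℓ prime, ℓ ≡ 5 (mod 8)}`**: for `ℓ ≠ 5` prime with
`ℓ ≡ 5 (mod 8)` and every globally minimal model `A` of `15A8^{(ℓ)}`: `∃ c_A ≠ 0, L_A' ≠ 0` with
`ι L_A' = C(c_A)·L₂(f_A, α_A)`, `μ(L_A') = 0`, **`λ(L_A') = 2`** (`kidaShiftAtTwo E₀ ℓ = 2`: `#Ẽ₀(𝔽_ℓ)` is even by
the rational `2`-torsion point, `v₂((ℓ²−1)/8) = 0`).  Unconditional modulo `hmod`.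
[cite: Matsuno2000, Thm. 3.1 (p. 86)] [cite: HatleyRay2024, Thm. 3.2 and Def. 3.5 (p. 12)] -/
theorem refFifteen_primeTwist_lam_eq_two (hW₀ : W₀ = ⟨1, 1, 1, 0, 0⟩) (hmod : exists_isNewformOf)
    {ℓ : ℕ} (hℓ : ℓ.Prime) (h8 : ℓ % 8 = 5) (h5 : ℓ ≠ 5)
    (hA : ∃ C : VariableChange ℚ, C • W₀.quadraticTwist (ℓ : ℚ) = A)
    {fA : CuspForm (Gamma0 (A.conductorNorm ℤ)) 2} (hfA : IsNewformOf A fA) :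
    ∃ (cA : ℚ) (LA' : IwasawaAlgebra 2), cA ≠ 0 ∧ LA' ≠ 0 ∧
      iwasawaToPowerSeries 2 LA' = PowerSeries.C (cA : ℚ_[2]) * padicLFunction fA (unitRoot A 2 : ℚ_[2]) ∧
      mu LA' = 0 ∧ lam LA' = 2 := by
  have hℓ2 : ℓ ≠ 2 := by omega
  have hℓ3 : ℓ ≠ 3 := by omega
  have h15 : ¬ ℓ ∣ 15 := by
    intro h
    rcases (Nat.Prime.dvd_mul hℓ).mp (show ℓ ∣ 3 * 5 from h) with h3 | h5'
    · exact hℓ3 ((Nat.prime_dvd_prime_iff_eq hℓ Nat.prime_three).mp h3)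
    · exact h5 ((Nat.prime_dvd_prime_iff_eq hℓ (by norm_num)).mp h5')
  have h30 : IsCoprime (ℓ : ℤ) 30 := by
    have h2 : Nat.Coprime ℓ 2 := (Nat.coprime_primes hℓ Nat.prime_two).mpr hℓ2
    have h3 : Nat.Coprime ℓ 3 := (Nat.coprime_primes hℓ Nat.prime_three).mpr hℓ3
    have h5' : Nat.Coprime ℓ 5 := (Nat.coprime_primes hℓ (by norm_num)).mpr h5
    have h : IsCoprime (ℓ : ℤ) ((2 * 3 * 5 : ℕ) : ℤ) := Nat.isCoprime_iff_coprime.mpr ((h2.mul_right h3).mul_right h5')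
    simpa using h
  have hA' : ∃ C : VariableChange ℚ, C • W₀.quadraticTwist ((ℓ : ℤ) : ℚ) = A := by simpa using hA
  obtain ⟨cA, LA', hcA, hLA'0, hLA', hμ, hlam⟩ :=
    refFifteen_twist_mu_eq_zero_and_lam_eq_kidaShift hW₀ hmod (d := (ℓ : ℤ)) (by exact_mod_cast hℓ.pos)
      (by omega) (Int.squarefree_natCast.mpr hℓ.squarefree) h30 hA' hfA
  refine ⟨cA, LA', hcA, hLA'0, hLA', hμ, ?_⟩
  subst hW₀
  rw [hlam]
  exact LambdaTransportDoorAtTwoMatsunoClass.kidaShiftAtTwo_prime_eq_two _ hℓ (Or.inr h8)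
    (reductionPointCount_refFifteen_even _ hℓ h15)

end Twist

end Summit.BirchSwinnertonDyer.BirchSwinnertonDyer.Theorems.RefFifteenHalvedTameCongruence

end
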